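import Summits.KontsevichZagierPeriods.KontsevichZagierPeriods.Theorems.RealOnePeriodRelations.Negative.Kit
import Summits.KontsevichZagierPeriods.KontsevichZagierPeriods.Theorems.SymplecticScissorsRealOnePeriodRelationsStubSaChart
import Summits.KontsevichZagierPeriods.KontsevichZagierPeriods.Theorems.SymplecticScissorsRealOnePeriodRelationsStubSaPathSubset
import Summits.KontsevichZagierPeriods.KontsevichZagierPeriods.Theorems.SymplecticScissorsRealOnePeriodRelationsStubGreenOnSquare
import Summits.KontsevichZagierPeriods.KontsevichZagierPeriods.Theorems.SymplecticScissorsRealOnePeriodRelationsStubCellGreen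
import Summits.KontsevichZagierPeriods.KontsevichZagierPeriods.Theorems.SymplecticScissorsRealOnePeriodRelationsStubHomotopyInvariance
import Summits.KontsevichZagierPeriods.KontsevichZagierPeriods.Theorems.SymplecticScissorsRealOnePeriodRelationsStubSaHomotopic
import Summits.KontsevichZagierPeriods.KontsevichZagierPeriods.Theorems.SymplecticScissorsRealOnePeriodRelationsStubExactDimOne
import Summits.KontsevichZagierPeriods.KontsevichZagierPeriods.Theorems.SymplecticScissorsRealOnePeriodRelationsStubRealises
import Summits.KontsevichZagierPeriods.KontsevichZagierPeriods.Theorems.SymplecticScissorsRealOnePeriodRelationsStubRetraction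
import Summits.KontsevichZagierPeriods.KontsevichZagierPeriods.Theorems.SymplecticScissorsRealOnePeriodRelationsNormalisationReduction
import Summits.KontsevichZagierPeriods.KontsevichZagierPeriods.Theorems.SymplecticScissorsRealOnePeriodRelationsStubRatCells
import Summits.KontsevichZagierPeriods.KontsevichZagierPeriods.Theorems.SymplecticScissorsRealOnePeriodRelationsStubRatReduce
import Summits.KontsevichZagierPeriods.KontsevichZagierPeriods.Theorems.SymplecticScissorsRealOnePeriodRelationsStubRatSymbol
import Summits.KontsevichZagierPeriods.KontsevichZagierPeriods.Theorems.SymplecticScissorsRealOnePeriodRelationsStubLayerGlue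
import Summits.KontsevichZagierPeriods.KontsevichZagierPeriods.Theorems.SymplecticScissorsRealOnePeriodRelationsStubEllPath
import Summits.KontsevichZagierPeriods.KontsevichZagierPeriods.Theorems.SymplecticScissorsRealOnePeriodRelationsStubEllForm
import Summits.KontsevichZagierPeriods.KontsevichZagierPeriods.Theorems.SymplecticScissorsRealOnePeriodRelationsStubEllIntegrand
import Summits.KontsevichZagierPeriods.KontsevichZagierPeriods.Theorems.SymplecticScissorsRealOnePeriodRelationsStubEllRealise
import Summits.KontsevichZagierPeriods.KontsevichZagierPeriods.Theorems.SymplecticScissorsRealOnePeriodRelationsStubEllTail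
import Literature.NumberTheory.Transcendental.CurvePeriodsPuncturedLineProofs
import Literature.NumberTheory.Transcendental.CurvePeriodsEllipticPathsHolds
import Literature.NumberTheory.EllipticCurves.LatticeJInvariant

/-!
# Crux `RealOnePeriodRelations` (stmt-KontsevichZagierPeriods-10042) — THE ELLIPTIC LAYER, UNCONDITIONALLY

Line `nash-retraction-thin-strip`, reshape 4 (gen-1 lead): for `E_{A,B} : y² = x³ + Ax + B` (`A, B` real algebraic) of a
non-CM lattice, every `ℤ`-combination with vanishing value of rational representations, first/second-kind real abelian
integrals on `E_{A,B}` and convergent tails lies in `M₁ = closure (1a ∪ 1b ∪ 2 ∪ Green)` (`realOnePeriodRelations_ellLayer`),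
from the landed elliptic and rational stubs, the glue, the tree's PROVED case of Huber–Wüstholz 13.3 (2) for `E_{A,B}` with the
punctured lines and the landed retraction `Θ`. [cite: HuberWustholz2022, Thm 13.3 (2), §13.2, Ch. 15] [cite: KontsevichZagier2001, §1.2]
-/

noncomputable section

open scoped BigOperators Polynomial
open Set MeasureTheory MvPolynomial
open Literature.NumberTheory.Transcendental Literature.NumberTheory.Transcendental.CurvePeriods
open Summit.KontsevichZagierPeriods.SymplecticScissors.RealOnePeriodRelationsNegative (M₁ H₁ crux_iff unitDom)

namespace Summit.KontsevichZagierPeriods.SymplecticScissors.RealOnePeriodRelations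

namespace EllipticLayer

/-- **`ellArcs`** (the registered `stub_ellArcs`): a bounded first/second-kind elliptic cell is, modulo `M₁`, the real
realisation of ONE period symbol `(E_{A,B}, G dx + H dy, γ)` with the same value. [cite: HuberWustholz2022, §3.3.1 and §13.2] -/
theorem ellArcs : ∀ (A B : ℝ), IsAlgebraic ℚ A → IsAlgebraic ℚ B → 4 * A ^ 3 + 27 * B ^ 2 ≠ 0 →
    ∀ ρ : KZ.IntegralRep 1,
    (∃ a b : ℝ, IsAlgebraic ℚ a ∧ IsAlgebraic ℚ b ∧ a < b ∧ ρ.domain = {z | z 0 ∈ Set.Ioo a b} ∧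
          (∀ x ∈ Set.Ioo a b, 0 < x ^ 3 + A * x + B) ∧
          ∃ P₁ P₂ P₃ : Polynomial (algebraicClosure ℚ ℝ), ∀ x ∈ Set.Ioo a b,
            ρ.integrand (fun _ => x) = Polynomial.aeval x P₁ + Polynomial.aeval x P₂ * Real.sqrt (x ^ 3 + A * x + B) +
              Polynomial.aeval x P₃ / Real.sqrt (x ^ 3 + A * x + B)) →
    ∃ (C : PeriodSymbol →₀ ℂ) (R : PeriodSymbol → KZ.IntegralRep 1), (∀ s, IsAlgebraic ℚ (C s)) ∧
      (∀ s ∈ C.support, s.Z = weierCurve (A : ℂ) (B : ℂ)) ∧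
      (∀ s ∈ C.support, IsSemialgebraicMapOn ℚ {z : Fin 1 → ℝ | z 0 ∈ Set.Icc (0 : ℝ) 1}
        (fun z => Fin.append (fun i => (s.γ.toFun (z 0) i).re) (fun i => (s.γ.toFun (z 0) i).im))) ∧
      (∀ s ∈ C.support, (R s).domain = {z | z 0 ∈ Set.Ioo (0 : ℝ) 1} ∧ ∀ z ∈ (R s).domain, (R s).integrand z =
        (C s * ∑ i, MvPolynomial.eval (s.γ.toFun (z 0)) (s.ω i) * deriv (fun u => s.γ.toFun u i) (z 0)).re) ∧
      evalCombination C = ((ρ.value : ℝ) : ℂ) ∧ KZ.of ρ - ∑ s ∈ C.support, KZ.of (R s) ∈ M₁ := by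
  classical
  intro A B hA hB hD ρ ⟨a, b, ha, hb, hab, hdom, hpos, P₁, P₂, P₃, hint⟩
  have value_of_unitCell : ∀ (ρ : KZ.IntegralRep 1), ρ.domain = {z | z 0 ∈ Set.Ioo (0 : ℝ) 1} →
      ρ.value = ∫ t in (0 : ℝ)..1, ρ.integrand (fun _ => t) := by
    intro ρ hdom
    rw [KZ.IntegralRep.value, hdom]
    have h := Summit.KontsevichZagierPeriods.SymplecticScissors.RealOnePeriodRelationsNegative.setIntegral_unitDom
      (fun t => ρ.integrand (fun _ => t))
    rw [← h]
    refine setIntegral_congr_fun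
      Summit.KontsevichZagierPeriods.SymplecticScissors.RealOnePeriodRelationsNegative.measurableSet_unitDom
      (fun z _ => ?_)
    show ρ.integrand z = ρ.integrand (fun _ => z 0)
    congr 1
    exact KZ.eq_const_apply_zero z
  obtain ⟨γ, hγ, hSA⟩ := stub_ellPath A B a b hA hB ha hb hab hD hpos
  obtain ⟨G, H, hG, hH, hGH⟩ := stub_ellForm A B hA hB hD P₁ P₂ P₃
  have hA' : IsAlgebraic ℚ (A : ℂ) := hA.algebraMap
  have hB' : IsAlgebraic ℚ (B : ℂ) := hB.algebraMap
  have hD' : Weier.disc (A : ℂ) (B : ℂ) ≠ 0 := by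
    unfold Weier.disc
    exact_mod_cast hD
  have hω : ∀ i, HasAlgCoeffs ((![G, H] : Fin 2 → MvPolynomial (Fin 2) ℂ) i) := by
    intro i
    fin_cases i
    · exact hG
    · exact hH
  set sy : PeriodSymbol := ⟨weierCurve (A : ℂ) (B : ℂ), Weier.isSmoothAffineCurve (A : ℂ) (B : ℂ) hA' hB' hD',
    ![G, H], hω, γ⟩ with hsy
  obtain ⟨R₁, hR₁dom, hR₁⟩ := stub_realises sy.Z sy.γ hSA sy.ω sy.ω_algebraic 1 isAlgebraic_one
  -- the cubic reparametrisation maps `(0,1)` into `(a,b)`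
  have hxmem : ∀ t ∈ Set.Ioo (0 : ℝ) 1, a + (b - a) * (3 * t ^ 2 - 2 * t ^ 3) ∈ Set.Ioo a b := by
    intro t ht
    have hba : 0 < b - a := sub_pos.2 hab
    have h1 : 0 < 3 * t ^ 2 - 2 * t ^ 3 := by nlinarith [ht.1, ht.2, sq_nonneg t]
    have h2 : 3 * t ^ 2 - 2 * t ^ 3 < 1 := by nlinarith [ht.1, ht.2, sq_nonneg (1 - t), mul_pos ht.1 ht.1]
    constructor <;> nlinarith [mul_pos hba h1, mul_pos hba (sub_pos.2 h2)]
  -- the realisation integrand on `(0,1)`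
  have hRint : ∀ t ∈ Set.Ioo (0 : ℝ) 1,
      (∑ i, MvPolynomial.eval (sy.γ.toFun t) (sy.ω i) * deriv (fun u => sy.γ.toFun u i) t) =
        ((ρ.integrand (fun _ => a + (b - a) * (3 * t ^ 2 - 2 * t ^ 3)) * ((b - a) * (6 * t - 6 * t ^ 2)) : ℝ) : ℂ) := by
    intro t ht
    have hx := hxmem t ht
    have hfpos := hpos _ hx
    set x : ℝ := a + (b - a) * (3 * t ^ 2 - 2 * t ^ 3) with hxdef
    set y : ℝ := Real.sqrt (x ^ 3 + A * x + B) with hydef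
    have hy0 : 0 < y := Real.sqrt_pos.2 hfpos
    have hy2 : y ^ 2 = x ^ 3 + A * x + B := Real.sq_sqrt hfpos.le
    have h1 := stub_ellIntegrand A B a b γ G H hγ t ht hfpos
    have hγt : γ.toFun t = ![(x : ℂ), (y : ℂ)] := by rw [hγ t]
    show (∑ i, MvPolynomial.eval (γ.toFun t) ((![G, H] : Fin 2 → MvPolynomial (Fin 2) ℂ) i) *
        deriv (fun u => γ.toFun u i) t) = _
    rw [h1, hγt, hGH x y hy2 hy0.ne', hint x hx, ← Complex.ofReal_mul]
  refine ⟨Finsupp.single sy 1, fun _ => R₁, ?_, ?_, ?_, ?_, ?_, ?_⟩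
  · intro t
    by_cases h : t = sy
    · subst h; simpa using isAlgebraic_one
    · rw [Finsupp.single_apply, if_neg (Ne.symm h)]; exact isAlgebraic_zero
  · intro t ht
    rw [Finsupp.support_single _ one_ne_zero, Finset.mem_singleton] at ht
    subst ht
    rfl
  · intro t ht
    rw [Finsupp.support_single _ one_ne_zero, Finset.mem_singleton] at ht
    subst ht
    exact hSA
  · intro t ht
    rw [Finsupp.support_single _ one_ne_zero, Finset.mem_singleton] at ht
    subst ht
    refine ⟨hR₁dom, fun z hz => ?_⟩
    rw [hR₁ z hz, Finsupp.single_eq_same]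
  · -- the value: `period sy = R₁.value = ρ.value`
    have hsub : KZ.of ρ - KZ.of R₁ ∈ M₁ := by
      refine stub_ellRealise a b ha hb hab ρ R₁ hdom hR₁dom fun t ht => ?_
      have hz : (fun _ : Fin 1 => t) ∈ R₁.domain := by rw [hR₁dom]; exact ht
      rw [hR₁ _ hz, one_mul]
      show (∑ i, MvPolynomial.eval (sy.γ.toFun t) (sy.ω i) * deriv (fun u => sy.γ.toFun u i) t).re = _
      rw [hRint t ht, Complex.ofReal_re]
    have hval : R₁.value = ρ.value := by
      have h := Summit.KontsevichZagierPeriods.SymplecticScissors.RealOnePeriodRelationsNegative.eval_eq_zero_of_mem_M₁ hsub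
      rw [map_sub, KZ.eval_of, KZ.eval_of, sub_eq_zero] at h
      exact h.symm
    rw [evalCombination, Finsupp.sum_single_index (by simp), one_mul, PeriodSymbol.period, ← hval,
      value_of_unitCell R₁ hR₁dom, ← intervalIntegral.integral_ofReal,
      intervalIntegral.integral_of_le zero_le_one, intervalIntegral.integral_of_le zero_le_one,
      integral_Ioc_eq_integral_Ioo, integral_Ioc_eq_integral_Ioo]
    refine setIntegral_congr_fun measurableSet_Ioo fun t ht => ?_
    have hz : (fun _ : Fin 1 => t) ∈ R₁.domain := by rw [hR₁dom]; exact ht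
    rw [hR₁ _ hz, one_mul]
    show (∑ i, MvPolynomial.eval (sy.γ.toFun t) (sy.ω i) * deriv (fun u => sy.γ.toFun u i) t) = _
    rw [hRint t ht, Complex.ofReal_re]
  · rw [Finsupp.support_single _ one_ne_zero, Finset.sum_singleton]
    refine stub_ellRealise a b ha hb hab ρ R₁ hdom hR₁dom fun t ht => ?_
    have hz : (fun _ : Fin 1 => t) ∈ R₁.domain := by rw [hR₁dom]; exact ht
    rw [hR₁ _ hz, one_mul]
    show (∑ i, MvPolynomial.eval (sy.γ.toFun t) (sy.ω i) * deriv (fun u => sy.γ.toFun u i) t).re = _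
    rw [hRint t ht, Complex.ofReal_re]


/-- CELLS of the elliptic layer (`stub_ratCells`, cells as they stand, tails by `stub_ellTail`). [cite: KontsevichZagier2001, §1.2] -/
theorem ellCells (A B : ℝ) (hA : IsAlgebraic ℚ A) (hB : IsAlgebraic ℚ B) :
    ∀ c : KZ.FormalRep, c ∈ AddSubgroup.closure ((fun r : KZ.IntegralRep 1 => KZ.of r) ''
      {r | r.IsRational ∨
        (∃ a b : ℝ, IsAlgebraic ℚ a ∧ IsAlgebraic ℚ b ∧ a < b ∧ r.domain = {z | z 0 ∈ Set.Ioo a b} ∧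
          (∀ x ∈ Set.Ioo a b, 0 < x ^ 3 + A * x + B) ∧
          ∃ P₁ P₂ P₃ : Polynomial (algebraicClosure ℚ ℝ), ∀ x ∈ Set.Ioo a b,
            r.integrand (fun _ => x) = Polynomial.aeval x P₁ + Polynomial.aeval x P₂ * Real.sqrt (x ^ 3 + A * x + B) +
              Polynomial.aeval x P₃ / Real.sqrt (x ^ 3 + A * x + B)) ∨
        (∃ e M c₀ : ℝ, IsAlgebraic ℚ e ∧ IsAlgebraic ℚ M ∧ IsAlgebraic ℚ c₀ ∧ e ^ 3 + A * e + B = 0 ∧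
          0 < 3 * e ^ 2 + A ∧ e < M ∧ (∀ x : ℝ, e < x → 0 < x ^ 3 + A * x + B) ∧ r.domain = {z | M < z 0} ∧
          ∀ z ∈ r.domain, r.integrand z = c₀ / Real.sqrt ((z 0) ^ 3 + A * (z 0) + B))}) →
    ∃ N : KZ.IntegralRep 1 →₀ ℤ, (∀ ρ ∈ N.support,
      (ρ.domain = {z | z 0 ∈ Set.Ioo (0 : ℝ) 1} ∧
          ∃ P Q : Polynomial (algebraicClosure ℚ ℝ),
            (∀ t ∈ Set.Ioo (0 : ℝ) 1, Polynomial.aeval t Q ≠ 0) ∧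
            ∀ t ∈ Set.Ioo (0 : ℝ) 1, ρ.integrand (fun _ => t) = Polynomial.aeval t P / Polynomial.aeval t Q) ∨
        (∃ a b : ℝ, IsAlgebraic ℚ a ∧ IsAlgebraic ℚ b ∧ a < b ∧ ρ.domain = {z | z 0 ∈ Set.Ioo a b} ∧
          (∀ x ∈ Set.Ioo a b, 0 < x ^ 3 + A * x + B) ∧
          ∃ P₁ P₂ P₃ : Polynomial (algebraicClosure ℚ ℝ), ∀ x ∈ Set.Ioo a b,
            ρ.integrand (fun _ => x) = Polynomial.aeval x P₁ + Polynomial.aeval x P₂ * Real.sqrt (x ^ 3 + A * x + B) +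
              Polynomial.aeval x P₃ / Real.sqrt (x ^ 3 + A * x + B))) ∧
      c - N.sum (fun ρ m => m • KZ.of ρ) ∈ M₁ := by
  classical
  intro c hc
  refine AddSubgroup.closure_induction (p := fun c _ => ∃ N : KZ.IntegralRep 1 →₀ ℤ, (∀ ρ ∈ N.support,
      (ρ.domain = {z | z 0 ∈ Set.Ioo (0 : ℝ) 1} ∧
          ∃ P Q : Polynomial (algebraicClosure ℚ ℝ),
            (∀ t ∈ Set.Ioo (0 : ℝ) 1, Polynomial.aeval t Q ≠ 0) ∧
            ∀ t ∈ Set.Ioo (0 : ℝ) 1, ρ.integrand (fun _ => t) = Polynomial.aeval t P / Polynomial.aeval t Q) ∨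
        (∃ a b : ℝ, IsAlgebraic ℚ a ∧ IsAlgebraic ℚ b ∧ a < b ∧ ρ.domain = {z | z 0 ∈ Set.Ioo a b} ∧
          (∀ x ∈ Set.Ioo a b, 0 < x ^ 3 + A * x + B) ∧
          ∃ P₁ P₂ P₃ : Polynomial (algebraicClosure ℚ ℝ), ∀ x ∈ Set.Ioo a b,
            ρ.integrand (fun _ => x) = Polynomial.aeval x P₁ + Polynomial.aeval x P₂ * Real.sqrt (x ^ 3 + A * x + B) +
              Polynomial.aeval x P₃ / Real.sqrt (x ^ 3 + A * x + B))) ∧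
      c - N.sum (fun ρ m => m • KZ.of ρ) ∈ M₁) ?_ ?_ ?_ ?_ hc
  · -- generators
    rintro _ ⟨r, hr, rfl⟩
    rcases hr with hrat | hcell | htail
    · obtain ⟨N, hN, hrN⟩ := RationalLayer.stub_ratCells (KZ.of r)
        (AddSubgroup.subset_closure ⟨r, hrat, rfl⟩)
      exact ⟨N, fun ρ hρ => Or.inl (hN ρ hρ), hrN⟩
    · refine ⟨Finsupp.single r 1, fun ρ hρ => ?_, ?_⟩
      · rw [Finsupp.support_single _ one_ne_zero, Finset.mem_singleton] at hρ
        subst hρ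
        exact Or.inr hcell
      · rw [Finsupp.sum_single_index (zero_zsmul _), one_zsmul, sub_self]
        exact M₁.zero_mem
    · obtain ⟨e, M, c₀, he, hM, hc₀, hfe, hfe', heM, hpos, hdom, hint⟩ := htail
      obtain ⟨r', hr'dom, hr'int, hrr'⟩ := stub_ellTail A B e M c₀ hA hB he hM hc₀ hfe hfe' heM hpos r hdom hint
      refine ⟨Finsupp.single r' 1, fun ρ hρ => ?_, ?_⟩
      · rw [Finsupp.support_single _ one_ne_zero, Finset.mem_singleton] at hρ
        subst hρ
        refine Or.inr ⟨e, e + (3 * e ^ 2 + A) / (M - e), he, ?_, ?_, hr'dom, ?_, ?_⟩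
        · exact he.add ((((isAlgebraic_nat 3).mul (he.pow 2)).add hA).mul ((hM.sub he).inv))
        · have h1 : 0 < (3 * e ^ 2 + A) / (M - e) := div_pos hfe' (sub_pos.2 heM)
          linarith
        · intro x hx
          exact hpos x hx.1
        · refine ⟨0, 0, Polynomial.C ⟨c₀, mem_algebraicClosure_iff.2 hc₀⟩, fun x hx => ?_⟩
          have h := hr'int (fun _ => x) (by rw [hr'dom]; exact hx)
          rw [h]
          simp [Polynomial.aeval_C]
      · rw [Finsupp.sum_single_index (zero_zsmul _), one_zsmul]
        exact hrr'
  · exact ⟨0, by simp, by simp [M₁.zero_mem]⟩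
  · rintro c c' _ _ ⟨N, hN, hcN⟩ ⟨N', hN', hcN'⟩
    refine ⟨N + N', fun ρ hρ => ?_, ?_⟩
    · rcases Finset.mem_union.mp (Finsupp.support_add hρ) with h | h
      · exact hN ρ h
      · exact hN' ρ h
    · rw [Cells.combo_add]
      convert M₁.add_mem hcN hcN' using 1
      abel
  · rintro c _ ⟨N, hN, hcN⟩
    refine ⟨-N, fun ρ hρ => hN ρ (by simpa [Finsupp.support_neg] using hρ), ?_⟩
    rw [Cells.combo_neg]
    convert M₁.neg_mem hcN using 1
    abel

/-- ARCS of the elliptic layer: punctured-line symbols on unit rational cells, `ellArcs` on elliptic cells. [cite: HuberWustholz2022, §3.3.1] -/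
theorem ellLayerArcs (A B : ℝ) (hA : IsAlgebraic ℚ A) (hB : IsAlgebraic ℚ B) (hD : 4 * A ^ 3 + 27 * B ^ 2 ≠ 0) :
    ∀ ρ : KZ.IntegralRep 1,
    ((ρ.domain = {z | z 0 ∈ Set.Ioo (0 : ℝ) 1} ∧
          ∃ P Q : Polynomial (algebraicClosure ℚ ℝ),
            (∀ t ∈ Set.Ioo (0 : ℝ) 1, Polynomial.aeval t Q ≠ 0) ∧
            ∀ t ∈ Set.Ioo (0 : ℝ) 1, ρ.integrand (fun _ => t) = Polynomial.aeval t P / Polynomial.aeval t Q) ∨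
        (∃ a b : ℝ, IsAlgebraic ℚ a ∧ IsAlgebraic ℚ b ∧ a < b ∧ ρ.domain = {z | z 0 ∈ Set.Ioo a b} ∧
          (∀ x ∈ Set.Ioo a b, 0 < x ^ 3 + A * x + B) ∧
          ∃ P₁ P₂ P₃ : Polynomial (algebraicClosure ℚ ℝ), ∀ x ∈ Set.Ioo a b,
            ρ.integrand (fun _ => x) = Polynomial.aeval x P₁ + Polynomial.aeval x P₂ * Real.sqrt (x ^ 3 + A * x + B) +
              Polynomial.aeval x P₃ / Real.sqrt (x ^ 3 + A * x + B))) →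
    ∃ (C : PeriodSymbol →₀ ℂ) (R : PeriodSymbol → KZ.IntegralRep 1), (∀ s, IsAlgebraic ℚ (C s)) ∧
      (∀ s ∈ C.support, (∃ (r : ℕ) (a : Fin r → ℂ), Function.Injective a ∧ (∀ i, IsAlgebraic ℚ (a i)) ∧
        s.Z = (⟨2, 1, ![X 1 * ∏ i, (X 0 - MvPolynomial.C (a i)) - 1]⟩ : CurveData)) ∨
        s.Z = weierCurve (A : ℂ) (B : ℂ)) ∧
      (∀ s ∈ C.support, IsSemialgebraicMapOn ℚ {z : Fin 1 → ℝ | z 0 ∈ Set.Icc (0 : ℝ) 1}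
        (fun z => Fin.append (fun i => (s.γ.toFun (z 0) i).re) (fun i => (s.γ.toFun (z 0) i).im))) ∧
      (∀ s ∈ C.support, (R s).domain = {z | z 0 ∈ Set.Ioo (0 : ℝ) 1} ∧ ∀ z ∈ (R s).domain, (R s).integrand z =
        (C s * ∑ i, MvPolynomial.eval (s.γ.toFun (z 0)) (s.ω i) * deriv (fun u => s.γ.toFun u i) (z 0)).re) ∧
      evalCombination C = ((ρ.value : ℝ) : ℂ) ∧ KZ.of ρ - ∑ s ∈ C.support, KZ.of (R s) ∈ M₁ := by
  classical
  have integrableOn_of_unitCell : ∀ (ρ : KZ.IntegralRep 1), ρ.domain = {z | z 0 ∈ Set.Ioo (0 : ℝ) 1} →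
      IntegrableOn (fun t : ℝ => ρ.integrand (fun _ => t)) (Set.Ioo (0 : ℝ) 1) := by
    intro ρ hdom
    set Φ := MeasurableEquiv.funUnique (Fin 1) ℝ with hΦ
    have hΦe : ⇑Φ.symm = fun t : ℝ => (fun _ : Fin 1 => t) := by
      funext t i
      rw [hΦ, MeasurableEquiv.funUnique_symm_apply]
      exact uniqueElim_const t i
    have h := ((volume_preserving_funUnique (Fin 1) ℝ).symm Φ).integrableOn_comp_preimage
      Φ.symm.measurableEmbedding (f := ρ.integrand) (s := ρ.domain)
    rw [hΦe] at h
    have h2 := h.mpr ρ.integrableOn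
    have hpre : (fun t : ℝ => (fun _ : Fin 1 => t)) ⁻¹' ρ.domain = Set.Ioo (0 : ℝ) 1 := by
      ext t; rw [hdom]; simp
    rwa [hpre] at h2
  have value_of_unitCell : ∀ (ρ : KZ.IntegralRep 1), ρ.domain = {z | z 0 ∈ Set.Ioo (0 : ℝ) 1} →
      ρ.value = ∫ t in (0 : ℝ)..1, ρ.integrand (fun _ => t) := by
    intro ρ hdom
    rw [KZ.IntegralRep.value, hdom]
    have h := Summit.KontsevichZagierPeriods.SymplecticScissors.RealOnePeriodRelationsNegative.setIntegral_unitDom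
      (fun t => ρ.integrand (fun _ => t))
    rw [← h]
    refine setIntegral_congr_fun
      Summit.KontsevichZagierPeriods.SymplecticScissors.RealOnePeriodRelationsNegative.measurableSet_unitDom
      (fun z _ => ?_)
    show ρ.integrand z = ρ.integrand (fun _ => z 0)
    congr 1
    exact KZ.eq_const_apply_zero z
  rintro ρ (hrat | hcell)
  · obtain ⟨hdom, P, Q, hQ, hf⟩ := hrat
    obtain ⟨P₀, Q₀, hQ₀, hf₀⟩ := RationalLayer.stub_ratReduce (fun t => ρ.integrand (fun _ => t)) P Q hQ hf
      (integrableOn_of_unitCell ρ hdom)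
    obtain ⟨s, hsZ, hSA, hint⟩ := RationalLayer.stub_ratSymbol P₀ Q₀ hQ₀
    obtain ⟨R₁, hR₁dom, hR₁⟩ := stub_realises s.Z s.γ hSA s.ω s.ω_algebraic 1 isAlgebraic_one
    refine ⟨Finsupp.single s 1, fun _ => R₁, ?_, ?_, ?_, ?_, ?_, ?_⟩
    · intro t
      by_cases h : t = s
      · subst h; simpa using isAlgebraic_one
      · rw [Finsupp.single_apply, if_neg (Ne.symm h)]; exact isAlgebraic_zero
    · intro t ht
      rw [Finsupp.support_single _ one_ne_zero, Finset.mem_singleton] at ht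
      subst ht
      exact Or.inl hsZ
    · intro t ht
      rw [Finsupp.support_single _ one_ne_zero, Finset.mem_singleton] at ht
      subst ht
      exact hSA
    · intro t ht
      rw [Finsupp.support_single _ one_ne_zero, Finset.mem_singleton] at ht
      subst ht
      refine ⟨hR₁dom, fun z hz => ?_⟩
      rw [hR₁ z hz, Finsupp.single_eq_same]
    · -- the value
      rw [evalCombination, Finsupp.sum_single_index (by simp), one_mul, PeriodSymbol.period,
        value_of_unitCell ρ hdom, ← intervalIntegral.integral_ofReal,
        intervalIntegral.integral_of_le zero_le_one, intervalIntegral.integral_of_le zero_le_one,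
        integral_Ioc_eq_integral_Ioo, integral_Ioc_eq_integral_Ioo]
      refine setIntegral_congr_fun measurableSet_Ioo fun t ht => ?_
      rw [hint t (Set.Ioo_subset_Icc_self ht), hf₀ t ht]
    · rw [Finsupp.support_single _ one_ne_zero, Finset.sum_singleton]
      refine NormalisationReduction.sub_mem_M₁_of_integrand_eq ρ R₁ hdom hR₁dom fun z hz => ?_
      rw [hR₁ z (by rw [hR₁dom]; rw [hdom] at hz; exact hz), one_mul]
      have hz' : z 0 ∈ Set.Ioo (0 : ℝ) 1 := by rw [hdom] at hz; exact hz
      rw [hint (z 0) (Set.Ioo_subset_Icc_self hz'), Complex.ofReal_re, ← hf₀ (z 0) hz']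
      congr 1
      exact KZ.eq_const_apply_zero z

  · obtain ⟨C, R, h1, h2, h3, h4, h5, h6⟩ := ellArcs A B hA hB hD ρ hcell
    exact ⟨C, R, h1, fun s hs => Or.inr (h2 s hs), h3, h4, h5, h6⟩

/-- **THE ELLIPTIC LAYER OF THE CRUX, UNCONDITIONALLY** (registered `realOnePeriodRelations_ellLayer`): for the affine
Weierstrass curve `E_{A,B}` (`A, B` real algebraic) of a lattice without complex multiplication, every `ℤ`-combination with
vanishing value of rational representations, first/second-kind elliptic representations on `E_{A,B}` and convergent tails lies
in the subgroup generated by the moves 1a, 1b, 2 and the Green generator — no hypothesis beyond the data.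
[cite: HuberWustholz2022, Thm 13.3 (2), §13.2, Ch. 15] [cite: KontsevichZagier2001, §1.2] -/
theorem realOnePeriodRelations_ellLayer : ∀ (A B : ℝ), IsAlgebraic ℚ A → IsAlgebraic ℚ B →
    ∀ (L : PeriodPair), L.g₂ = -4 * (A : ℂ) → L.g₃ = -4 * (B : ℂ) → ¬ L.HasCM →
    ∀ c : KZ.FormalRep, c ∈ AddSubgroup.closure ((fun r : KZ.IntegralRep 1 => KZ.of r) ''
      {r | r.IsRational ∨
        (∃ a b : ℝ, IsAlgebraic ℚ a ∧ IsAlgebraic ℚ b ∧ a < b ∧ r.domain = {z | z 0 ∈ Set.Ioo a b} ∧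
          (∀ x ∈ Set.Ioo a b, 0 < x ^ 3 + A * x + B) ∧
          ∃ P₁ P₂ P₃ : Polynomial (algebraicClosure ℚ ℝ), ∀ x ∈ Set.Ioo a b,
            r.integrand (fun _ => x) = Polynomial.aeval x P₁ + Polynomial.aeval x P₂ * Real.sqrt (x ^ 3 + A * x + B) +
              Polynomial.aeval x P₃ / Real.sqrt (x ^ 3 + A * x + B)) ∨
        (∃ e M c₀ : ℝ, IsAlgebraic ℚ e ∧ IsAlgebraic ℚ M ∧ IsAlgebraic ℚ c₀ ∧ e ^ 3 + A * e + B = 0 ∧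
          0 < 3 * e ^ 2 + A ∧ e < M ∧ (∀ x : ℝ, e < x → 0 < x ^ 3 + A * x + B) ∧ r.domain = {z | M < z 0} ∧
          ∀ z ∈ r.domain, r.integrand z = c₀ / Real.sqrt ((z 0) ^ 3 + A * (z 0) + B))}) →
    KZ.eval c = 0 →
    c ∈ AddSubgroup.closure (KZ.domainAddRel ∪ KZ.integrandAddRel ∪ KZ.changeOfVariablesRel ∪
      {g : KZ.FormalRep | ∃ (Δ : Set (Fin 2 → ℝ)) (A B S : (Fin 2 → ℝ) → ℝ) (r₀₁ r₁₂ r₀₂ : KZ.IntegralRep 1),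
        Δ = {p | 0 ≤ p 0 ∧ 0 ≤ p 1 ∧ p 0 + p 1 ≤ 1} ∧ IsSemialgebraicFunOn ℚ Δ A ∧ IsSemialgebraicFunOn ℚ Δ B ∧
        ContinuousOn A Δ ∧ ContinuousOn B Δ ∧
        (∀ p : Fin 2 → ℝ, 0 < p 0 → 0 < p 1 → p 0 + p 1 < 1 →
          HasFDerivAt S (A p • ContinuousLinearMap.proj (R := ℝ) (φ := fun _ : Fin 2 => ℝ) 0 +
            B p • ContinuousLinearMap.proj (R := ℝ) (φ := fun _ : Fin 2 => ℝ) 1) p) ∧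
        r₀₁.domain = {z | z 0 ∈ Set.Ioo 0 1} ∧ r₁₂.domain = {z | z 0 ∈ Set.Ioo 0 1} ∧
        r₀₂.domain = {z | z 0 ∈ Set.Ioo 0 1} ∧ (∀ z ∈ r₀₁.domain, r₀₁.integrand z = A ![z 0, 0]) ∧
        (∀ z ∈ r₁₂.domain, r₁₂.integrand z = B ![1 - z 0, z 0] - A ![1 - z 0, z 0]) ∧
        (∀ z ∈ r₀₂.domain, r₀₂.integrand z = B ![0, z 0]) ∧ g = KZ.of r₀₁ + KZ.of r₁₂ - KZ.of r₀₂}) := by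
  intro A B hA hB L hL₂ hL₃ hCM c hc heval
  change c ∈ M₁
  have hD : 4 * A ^ 3 + 27 * B ^ 2 ≠ 0 := by
    intro h
    apply L.discr_ne_zero
    rw [hL₂, hL₃]
    have h' : ((4 * A ^ 3 + 27 * B ^ 2 : ℝ) : ℂ) = 0 := by rw [h]; simp
    push_cast at h'
    linear_combination (-16 : ℂ) * h'
  obtain ⟨C, R, hCalg, hCsupp, hSA, hReal, hCeval, hcR⟩ :=
    RationalLayer.stub_layerGlue _ _ _ (ellCells A B hA hB) (ellLayerArcs A B hA hB hD) c hc
  have hC0 : evalCombination C = 0 := by rw [hCeval, heval]; simp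
  obtain ⟨k, ρ, a, hρ, ha, hCsum⟩ :=
    huberWustholzCurvePeriods_weierCurve_puncturedLine L hL₂ hL₃ hA.algebraMap hB.algebraMap hCM C hCalg
      (fun s hs => (hCsupp s hs).elim Or.inl (fun h => Or.inr (Or.inl h))) hC0
  obtain ⟨Θ, hΘrel, hΘreal⟩ :=
    stub_retraction (stub_saHomotopic stub_saChart (stub_saPathSubset stub_saChart))
      (stub_homotopyInvariance stub_saChart (stub_saPathSubset stub_saChart) (stub_cellGreen stub_greenOnSquare))
      stub_exactDimOne stub_realises
  have h1 : (∑ s ∈ C.support, Θ (C s) s) ∈ M₁ := by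
    have h := hΘrel k ρ a hρ ha
    rw [← hCsum] at h
    exact h
  have h2 : (∑ s ∈ C.support, (Θ (C s) s - KZ.of (R s))) ∈ M₁ :=
    sum_mem fun s hs => hΘreal s (C s) (hCalg s) (hSA s hs) (R s) (hReal s hs)
  have h3 : c = (c - ∑ s ∈ C.support, KZ.of (R s)) - (∑ s ∈ C.support, (Θ (C s) s - KZ.of (R s))) +
      ∑ s ∈ C.support, Θ (C s) s := by
    rw [Finset.sum_sub_distrib]
    abel
  rw [h3]
  exact M₁.add_mem (M₁.sub_mem hcR h2) h1


end EllipticLayer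

end Summit.KontsevichZagierPeriods.SymplecticScissors.RealOnePeriodRelations

end
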